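import Literature.MathematicalPhysics.QuantumFieldTheory.Balaban1983to89.B6RandomWalk

/-!
# `Balaban1983to89.B11Eq73KernelDecay` — T. Bałaban, *The variational problem and background fields in renormalization group method for lattice gauge theories*, Commun. Math. Phys. **102** (1985) 277–309 [Balaban1985Variational]: (73) p. 289 — the exponential decay of the kernel `𝔇(A′; c, b)` of the functional derivative of `D`, «The formula (70) and the inequalities (71), (72) give finally the following inequality (73)» PROVED as the printed three-line derivation (kernel composition (70), the kernel bound (71) of `(I + ℜ)⁻¹`, the bound (72) with the locality of `C_j`, and the triangle inequality (2.54) of [3]) over the abstract multiscale geometry `B6.Geometry`, with the print's `O(1)` made explicit (theorem-only module)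

statement-level skeleton of published theorems with citation tags; proofs where landed; nothing here is a claim about the Yang–Mills mass gap

PDF held: `paper:balaban1985-cmp102-variational-background` (journal page = PDF page + 276).  Render
`run/shared/lean/pub/pub-balaban/b2b-balaban-ref1/pages/1985-cmp102-variational-background/…-p013-x2.png` (p. 289) READ
AS IMAGE by this seat (lit-balaban reader/typer r08, gen 3, 2026-08-21).

CITATION HEADER (lean-in-tree rule 2026-08-18).  WHAT IS REPRODUCED: SKELETON row `B11.Eq73` = display (73) p. 289 —
so far `typed` only (a clause of `B11.Prop3Printed`, the shape `B11SectG.HasMaj`).  Sibling modules: `B11Eq63Functional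
Derivative` ((63)–(70): existence of `𝔇` and the solution formula (70)), `B11SectG` ((71) as the block-majorant Neumann
bound `neumann_majorant`, Lemma 2.1 [3] as `RowSum`), `B7.Prop5Printed` ((72) = [4] Prop. 5), `B6RandomWalk` ((2.54)
`Triangle254`, imported), `B11KernelDictionary` (kernel ⟷ majorant readings).

THE PRINT (p. 289 [PDF 13], verbatim from the render).  «Equation (68) is uniquely solvable by a convergent Neumann
series,
  𝔇(A′) = (I + ℜ)⁻¹ L^{j(·)}η ((δ/δA) C)(A′ − HD(A′)), (70)
where j(c) = j for c ∈ Λ_j, and C(A, c) = C_j(LʲηA, c) for c ∈ Λ_j. A kernel of the operator (I + ℜ)⁻¹ satisfies the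
bound
  |(I + ℜ)⁻¹(c, c′)| ≦ (1 − 9C₂B₀ε₃dc₁(½))⁻¹(L^{j′}η)^{−d}e^{−(1/2)δ₀d(c₋,c′₋)} ≦ 2(L^{j′}η)^{−d}e^{−(1/2)δ₀d(c₋,c′₋)} (71)
for ε₃ sufficiently small, which follows from Lemma 2.1 [3]. Proposition 5 of [4] implies that
  |Lʲη (δC_j/δA)(Lʲη(A′ − HD(A′)))| ≦ Lʲη(Lʲη)^{−d}C₃2ε₃. (72)
Let us notice that the factor (Lʲη)^{−d} comes from the change of scale: the derivative of C_j has the estimate (157)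
in [4] on L^{−j}-scale, and here we consider the derivative on η-scale. The formula (70) and the inequalities (71), (72)
give finally the following inequality,
  |𝔇(A′; c, b)| ≦ O(1)C₃ε₃(Lʲη)^{−d+1}e^{−(1/2)δ₀d(c₋,y)}, b ∈ Bʲ(y), y ∈ Λ_j. (73)»
and Proposition 3 (same page): «… for A′ satisfying (43) with ε₃ sufficiently small (e.g. 18C₂B₀dc₁(½)ε₃ ≦ 1,
2ε₃ ≦ c₄) … its functional derivative satisfies the bound (73).»  Around it: (66) p. 288 «Σ_{c′∈𝔅_k}(L^{j′}η)^d
H(b′, c′)𝔇(A′; c′, b)» (the pairing on `𝔅_k` carries the weight `(L^{j′}η)^d`); (69) p. 288 «sup_{b ⊂ Bʲ(c₋)∪Bʲ(c₊)}»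
(the functional `C_j(·, c)` depends on the field only on the bonds of `Bʲ(c₋) ∪ Bʲ(c₊)`, [4]); [3] (2.54) p. 233 «This
is of course the triangle inequality for our distance.»

DICTIONARY (abstract; nothing re-declared).  `g : B6.Geometry` = the multiscale set `𝔅_k` with the distance `d` of [3]
(`g.dist`, triangle inequality `B6RandomWalk.Triangle254 g` as hypothesis); `ιF` = the index set of the values of
`D`/`𝔇` («bonds of 𝔅_k», `pt c = c₋`); `ιE` = the bonds of `Ω₀` (`blk b = y` with `b ∈ Bʲ(y)`); `wF c′ = (L^{j′}η)^d` the
pairing weight on `𝔅_k`; `Gk` = «a kernel of the operator (I + ℜ)⁻¹» relative to that pairing; `Kk c′ b` = the kernel of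
the right-hand side of (70), `Lʲη(δC_j/δA(b))(Lʲη(A′ − HD(A′)), c′)`; `Dk c b = 𝔇(A′; c, b)`; `t y = L^{j(y)}η` the scale
length.  The three printed inputs are the hypotheses `h70` (kernel composition: `𝔇(c, b) = Σ_{c′}(L^{j′}η)^d (I + ℜ)⁻¹(c,
c′) K(c′, b)`), `h71` (second member of (71)), `h72` ((72), read pointwise for the kernel in `b`), together with the
LOCALITY of `C_j` («b ⊂ Bʲ(c′₋) ∪ Bʲ(c′₊)», hypotheses `hloc`/`hN`/`hr`: `K(c′, b) = 0` unless `c′` is one of at most `n₀`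
indices near the block `y ∋ b`, `d(c′₋, y) ≦ r`) and the comparability of the scale prefactors of neighbouring sites
(`hscale`, constant `m₀`) — the geometric facts the print's `O(1)` absorbs.

WHAT IS CERTIFIED (kernel, sorry-free; axioms `propext` / `Classical.choice` / `Quot.sound`).
§1 `ineq71_second` (the second member of (71) under Proposition 3's «18C₂B₀dc₁(½)ε₃ ≦ 1»: `(1 − 9C₂B₀ε₃dc₁(½))⁻¹ ≦ 2`),
`exp_shift` ((2.54): `e^{−δd(a,x)} ≦ e^{δr}e^{−δd(a,y)}` for `d(x, y) ≦ r`).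
§2 **(73) from (70), (71), (72)** `ineq73`: `|𝔇(c, b)| ≦ 2n₀e^{½δ₀r}·M(b)·e^{−½δ₀d(c₋,y)}` for any bound `M(b)` of
`|K(c′, b)|` over the `c′` that see `b`; **(73) as printed** `ineq73_printed`: with (72) VERBATIM (`|K(c′, b)| ≦
L^{j′}η(L^{j′}η)^{−d}C₃2ε₃`, `j′ = j(c′)`) and `hscale`:
`|𝔇(A′; c, b)| ≦ (4n₀m₀e^{½δ₀r})·C₃ε₃·(Lʲη)(Lʲη)^{−d}·e^{−½δ₀d(c₋,y)}`, `j = j(y)`, i.e. (73) with `O(1) = 4n₀m₀e^{½δ₀r}`.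

HONEST SCOPE — what is NOT claimed.  (i) (70), (71), (72) are INPUTS (rows `B11.Eq70` — `B11Eq63FunctionalDerivative.eq70`
for the formula, `B11SectG.neumann_majorant` for the majorant form of (71) —, `B11.Eq72` = `B7.Prop5Printed`); this
module certifies only the printed passage «(70) and (71), (72) give (73)».  (ii) The lattice objects (`C_j`, `H`, `Λ_j`,
`Bʲ(y)`) are not constructed; locality and scale comparability enter as the hypotheses named above, and the print's
`O(1)` is the explicit `4n₀m₀e^{½δ₀r}`.  (iii) «matrix indices suppressed» as in the print: scalar kernels (`|·|` on `ℝ`);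
the `gᶜ ⊗ gᶜ`-matrix version is the same estimate entrywise/in operator norm and is not separately typed.  (iv) The
remark after Proposition 3 («𝔇₂(A′) … the bound (73) with ε₃² instead of ε₃») is not typed.  (v) Nothing here is
progress on the summit `Summit.QuantumFields`.  Unit `lit-balaban-r08` gen 3 (row `B11.Eq73` of
`HOME/lit-balaban-r08/ROWS-B11.md`, HOME = `run/shared/lean/pub/lit-balaban/`).
-/

namespace Literature.MathematicalPhysics.QuantumFieldTheory.Balaban1983to89.B11Eq73KernelDecay

open Literature.MathematicalPhysics.QuantumFieldTheory.Balaban1983to89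
open Finset B6RandomWalk

/-! ## §1 The second member of (71) and the triangle-inequality shift -/
section Prelim

/-- **(71), second member** «≦ 2(L^{j′}η)^{−d}e^{−(1/2)δ₀d(c₋,c′₋)} for ε₃ sufficiently small»: under Proposition 3's
«18C₂B₀dc₁(½)ε₃ ≦ 1» the Neumann factor satisfies `(1 − 9C₂B₀ε₃dc₁(½))⁻¹ ≦ 2`.
[cite: Balaban1985Variational, (71) p.289, Prop. 3 p.289] -/
theorem ineq71_second {C₂ B₀ ε₃ c₁ : ℝ} {d : ℕ} (hsmall : 18 * C₂ * B₀ * d * c₁ * ε₃ ≤ 1) :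
    (1 - 9 * C₂ * B₀ * ε₃ * d * c₁)⁻¹ ≤ 2 := by
  have hq : 9 * C₂ * B₀ * ε₃ * d * c₁ ≤ 1 / 2 := by nlinarith
  have hpos : 0 < 1 - 9 * C₂ * B₀ * ε₃ * d * c₁ := by linarith
  rw [inv_le_comm₀ hpos (by norm_num : (0 : ℝ) < 2)]
  linarith

/-- With the prefactor: `(1 − 9C₂B₀ε₃dc₁(½))⁻¹·w⁻¹e^{−½δ₀d} ≦ 2w⁻¹e^{−½δ₀d}` ((71), first ⇒ second member).
[cite: Balaban1985Variational, (71) p.289] -/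
theorem ineq71_second' {C₂ B₀ ε₃ c₁ w x : ℝ} {d : ℕ} (hsmall : 18 * C₂ * B₀ * d * c₁ * ε₃ ≤ 1) (hw : 0 ≤ w) :
    (1 - 9 * C₂ * B₀ * ε₃ * d * c₁)⁻¹ * (w⁻¹ * Real.exp x) ≤ 2 * (w⁻¹ * Real.exp x) :=
  mul_le_mul_of_nonneg_right (ineq71_second hsmall) (mul_nonneg (inv_nonneg.mpr hw) (Real.exp_pos x).le)

variable {g : B6.Geometry}

/-- **[3] (2.54)** used as in the print's `O(1)`: if `d(x, y) ≦ r` then `e^{−δd(a,x)} ≦ e^{δr}·e^{−δd(a,y)}` (`δ ≧ 0`).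
[cite: Balaban1984PropagatorsII, (2.54) p.233; Balaban1985Variational, (73) p.289] -/
theorem exp_shift (htri : Triangle254 g) {δ r : ℝ} (hδ : 0 ≤ δ) {a x y : g.Site} (hxy : g.dist x y ≤ r) :
    Real.exp (-(δ * g.dist a x)) ≤ Real.exp (δ * r) * Real.exp (-(δ * g.dist a y)) := by
  rw [← Real.exp_add]
  apply Real.exp_le_exp.mpr
  have h1 : g.dist a y ≤ g.dist a x + g.dist x y := htri a x y
  have h2 : δ * g.dist a y ≤ δ * (g.dist a x + r) := mul_le_mul_of_nonneg_left (by linarith) hδ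
  linarith

end Prelim

/-! ## §2 (73) from (70), (71), (72) -/
section Eq73

variable {g : B6.Geometry} {ιE ιF : Type*} [Fintype ιF]

/-- **(73) from (70), (71), (72)** «The formula (70) and the inequalities (71), (72) give finally the following
inequality».  Inputs: (70) as the kernel composition `𝔇(c, b) = Σ_{c′}(L^{j′}η)^d (I + ℜ)⁻¹(c, c′)K(c′, b)`; (71) (second
member) `|(I + ℜ)⁻¹(c, c′)| ≦ 2(L^{j′}η)^{−d}e^{−½δ₀d(c₋,c′₋)}`; (72) read for the kernel, `|K(c′, b)| ≦ M(b)` for the `c′`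
that see `b`; locality of `C_j` (`K(c′, b) = 0` unless `c′ ∈ N(b)`, `#N(b) ≦ n₀`, `d(c′₋, y) ≦ r` for `c′ ∈ N(b)`, `b ∈
Bʲ(y)`); the triangle inequality (2.54).  Conclusion: `|𝔇(c, b)| ≦ 2n₀e^{½δ₀r}M(b)e^{−½δ₀d(c₋,y)}`.
[cite: Balaban1985Variational, (70)-(73) p.289] -/
theorem ineq73 (htri : Triangle254 g) {δ₀ r : ℝ} (hδ₀ : 0 ≤ δ₀)
    (pt : ιF → g.Site) (blk : ιE → g.Site) (wF : ιF → ℝ) (hwF : ∀ c', 0 < wF c')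
    (Gk : ιF → ιF → ℝ) (Kk Dk : ιF → ιE → ℝ) (M : ιE → ℝ) (hM : ∀ b, 0 ≤ M b)
    (N : ιE → Finset ιF) (n₀ : ℕ)
    (h70 : ∀ c b, Dk c b = ∑ c', wF c' * Gk c c' * Kk c' b)
    (h71 : ∀ c c', |Gk c c'| ≤ 2 * (wF c')⁻¹ * Real.exp (-(δ₀ / 2 * g.dist (pt c) (pt c'))))
    (h72 : ∀ b, ∀ c' ∈ N b, |Kk c' b| ≤ M b)
    (hloc : ∀ c' b, c' ∉ N b → Kk c' b = 0)
    (hN : ∀ b, (N b).card ≤ n₀) (hr : ∀ b, ∀ c' ∈ N b, g.dist (pt c') (blk b) ≤ r)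
    (c : ιF) (b : ιE) :
    |Dk c b| ≤ 2 * n₀ * Real.exp (δ₀ / 2 * r) * M b * Real.exp (-(δ₀ / 2 * g.dist (pt c) (blk b))) := by
  rw [h70]
  -- (70): only the `c′` that see `b` contribute
  have hsum : ∑ c', wF c' * Gk c c' * Kk c' b = ∑ c' ∈ N b, wF c' * Gk c c' * Kk c' b := by
    rw [← Finset.sum_subset (Finset.subset_univ (N b))]
    intro c' _ hc'
    rw [hloc c' b hc', mul_zero]
  rw [hsum]
  -- each term: (71) × (72), the weight `(L^{j′}η)^d` cancels, then (2.54)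
  have hterm : ∀ c' ∈ N b, |wF c' * Gk c c' * Kk c' b|
      ≤ 2 * Real.exp (δ₀ / 2 * r) * M b * Real.exp (-(δ₀ / 2 * g.dist (pt c) (blk b))) := by
    intro c' hc'
    have hw : 0 < wF c' := hwF c'
    rw [abs_mul, abs_mul, abs_of_pos hw]
    have h1 : wF c' * |Gk c c'| ≤ 2 * Real.exp (-(δ₀ / 2 * g.dist (pt c) (pt c'))) := by
      have h := mul_le_mul_of_nonneg_left (h71 c c') hw.le
      have hcancel : wF c' * (2 * (wF c')⁻¹ * Real.exp (-(δ₀ / 2 * g.dist (pt c) (pt c'))))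
          = 2 * Real.exp (-(δ₀ / 2 * g.dist (pt c) (pt c'))) := by
        field_simp
      rwa [hcancel] at h
    have h2 : wF c' * |Gk c c'| * |Kk c' b| ≤ 2 * Real.exp (-(δ₀ / 2 * g.dist (pt c) (pt c'))) * M b :=
      mul_le_mul h1 (h72 b c' hc') (abs_nonneg _) (by positivity)
    have h3 : Real.exp (-(δ₀ / 2 * g.dist (pt c) (pt c')))
        ≤ Real.exp (δ₀ / 2 * r) * Real.exp (-(δ₀ / 2 * g.dist (pt c) (blk b))) :=
      exp_shift htri (δ := δ₀ / 2) (by positivity) (hr b c' hc')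
    have h4 : 2 * Real.exp (-(δ₀ / 2 * g.dist (pt c) (pt c'))) * M b
        ≤ 2 * (Real.exp (δ₀ / 2 * r) * Real.exp (-(δ₀ / 2 * g.dist (pt c) (blk b)))) * M b :=
      mul_le_mul_of_nonneg_right (mul_le_mul_of_nonneg_left h3 (by norm_num)) (hM b)
    calc wF c' * |Gk c c'| * |Kk c' b|
        ≤ 2 * (Real.exp (δ₀ / 2 * r) * Real.exp (-(δ₀ / 2 * g.dist (pt c) (blk b)))) * M b := h2.trans h4
      _ = 2 * Real.exp (δ₀ / 2 * r) * M b * Real.exp (-(δ₀ / 2 * g.dist (pt c) (blk b))) := by ring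
  have hX : 0 ≤ 2 * Real.exp (δ₀ / 2 * r) * M b * Real.exp (-(δ₀ / 2 * g.dist (pt c) (blk b))) :=
    mul_nonneg (mul_nonneg (by positivity) (hM b)) (Real.exp_pos _).le
  calc |∑ c' ∈ N b, wF c' * Gk c c' * Kk c' b|
      ≤ ∑ c' ∈ N b, |wF c' * Gk c c' * Kk c' b| := Finset.abs_sum_le_sum_abs _ _
    _ ≤ ∑ c' ∈ N b, 2 * Real.exp (δ₀ / 2 * r) * M b * Real.exp (-(δ₀ / 2 * g.dist (pt c) (blk b))) :=
        Finset.sum_le_sum hterm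
    _ = (N b).card * (2 * Real.exp (δ₀ / 2 * r) * M b * Real.exp (-(δ₀ / 2 * g.dist (pt c) (blk b)))) := by
        rw [Finset.sum_const, nsmul_eq_mul]
    _ ≤ n₀ * (2 * Real.exp (δ₀ / 2 * r) * M b * Real.exp (-(δ₀ / 2 * g.dist (pt c) (blk b)))) :=
        mul_le_mul_of_nonneg_right (by exact_mod_cast hN b) hX
    _ = 2 * n₀ * Real.exp (δ₀ / 2 * r) * M b * Real.exp (-(δ₀ / 2 * g.dist (pt c) (blk b))) := by ring

/-- **(73) as printed** «|𝔇(A′; c, b)| ≦ O(1)C₃ε₃(Lʲη)^{−d+1}e^{−(1/2)δ₀d(c₋,y)}, b ∈ Bʲ(y), y ∈ Λ_j», with (72)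
VERBATIM as the kernel bound `|K(c′, b)| ≦ L^{j′}η(L^{j′}η)^{−d}C₃2ε₃` (`j′ = j(c′)`, scale length `t = L^{j(·)}η > 0`) and
the comparability `L^{j′}η(L^{j′}η)^{−d} ≦ m₀·Lʲη(Lʲη)^{−d}` of the prefactors at the `c′` that see `b ∈ Bʲ(y)`; the
print's `O(1)` is `4n₀m₀e^{½δ₀r}`. [cite: Balaban1985Variational, (73) p.289] -/
theorem ineq73_printed (htri : Triangle254 g) {δ₀ r m₀ C₃ ε₃ : ℝ} {d : ℕ} (hδ₀ : 0 ≤ δ₀) (hm₀ : 0 ≤ m₀)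
    (hC₃ : 0 ≤ C₃) (hε₃ : 0 ≤ ε₃)
    (pt : ιF → g.Site) (blk : ιE → g.Site) (t : g.Site → ℝ) (ht : ∀ y, 0 < t y)
    (wF : ιF → ℝ) (hwF : ∀ c', 0 < wF c')
    (Gk : ιF → ιF → ℝ) (Kk Dk : ιF → ιE → ℝ) (N : ιE → Finset ιF) (n₀ : ℕ)
    (h70 : ∀ c b, Dk c b = ∑ c', wF c' * Gk c c' * Kk c' b)
    (h71 : ∀ c c', |Gk c c'| ≤ 2 * (wF c')⁻¹ * Real.exp (-(δ₀ / 2 * g.dist (pt c) (pt c'))))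
    (h72 : ∀ c' b, |Kk c' b| ≤ t (pt c') / t (pt c') ^ d * C₃ * (2 * ε₃))
    (hloc : ∀ c' b, c' ∉ N b → Kk c' b = 0)
    (hN : ∀ b, (N b).card ≤ n₀) (hr : ∀ b, ∀ c' ∈ N b, g.dist (pt c') (blk b) ≤ r)
    (hscale : ∀ b, ∀ c' ∈ N b, t (pt c') / t (pt c') ^ d ≤ m₀ * (t (blk b) / t (blk b) ^ d))
    (c : ιF) (b : ιE) :
    |Dk c b| ≤ (4 * n₀ * m₀ * Real.exp (δ₀ / 2 * r)) * C₃ * ε₃ * (t (blk b) / t (blk b) ^ d)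
        * Real.exp (-(δ₀ / 2 * g.dist (pt c) (blk b))) := by
  have hM : ∀ b, 0 ≤ m₀ * (t (blk b) / t (blk b) ^ d) * C₃ * (2 * ε₃) := fun b =>
    mul_nonneg (mul_nonneg (mul_nonneg hm₀ (div_nonneg (ht _).le (pow_nonneg (ht _).le _))) hC₃) (by linarith)
  have h72' : ∀ b, ∀ c' ∈ N b, |Kk c' b| ≤ m₀ * (t (blk b) / t (blk b) ^ d) * C₃ * (2 * ε₃) :=
    fun b c' hc' => (h72 c' b).trans
      (mul_le_mul_of_nonneg_right (mul_le_mul_of_nonneg_right (hscale b c' hc') hC₃) (by linarith))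
  have h := ineq73 htri hδ₀ pt blk wF hwF Gk Kk Dk _ hM N n₀ h70 h71 h72' hloc hN hr c b
  calc |Dk c b| ≤ _ := h
    _ = (4 * n₀ * m₀ * Real.exp (δ₀ / 2 * r)) * C₃ * ε₃ * (t (blk b) / t (blk b) ^ d)
        * Real.exp (-(δ₀ / 2 * g.dist (pt c) (blk b))) := by ring

end Eq73

end Literature.MathematicalPhysics.QuantumFieldTheory.Balaban1983to89.B11Eq73KernelDecay
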